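import Summits.QuantumFields.BalabanUV.T4Continuum.Support.B13HistInsertionLoc
import Summits.QuantumFields.BalabanUV.T4Continuum.Support.InsertionLinearClassLocWitness

/-!
# B13HistInsertionLocWitness — kernel witness for the per-read-out kernel binders of `B13HistInsertionLoc` (owner ruling R22 applied
# to the finite-rank kernel class): on a sup-normed history space with `N` positions per scale the GLOBAL kernel budget `KerBudget` and
# kernel rate `KerRate` force `c ≥ N`, `δv ≥ N` (volume-extensive), while the PER-READ-OUT ones hold with `c = δv = 1` for every `N`,
# and the consumers (W3 `InsScaleBound`, W4 `InsertionRate`) run end to end with constants independent of `N`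
# (cell `pub-balaban`, T⁴ fan-out, `HOME/BINDER-OWNERS.md` row NE5; unit `b2b-balaban-t4-ne5-formalise-leaf-04`, gen 2; owner RULING R26
# «the toy witness is welcome as a separate module», row holder leaf-06 «no veto, adopt»)

HONEST FRAMING (T4-DAG PAGE 1).  Rung (B)+1 on ONE finite four-torus — NOT infinite volume, NOT a mass gap, NOT the Clay problem.  NE5 is
NOT PRINTED and NOT PROVED (spine 0/9).  A TOY: nothing of Bałaban's series is modelled or asserted; 0 cite tags.  HONEST DEPENDENCY (cell,
verbatim): continuum YM on T⁴ ⇐ BetaPertH ∧ nine spine estimates (0/9 proved); BetaPertH ⇐ (D1) ∧ (D4) ∧ CAP+tail; G-an2-4 gates asym, D1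
and NE2/3/4.

WHAT THIS MODULE IS (the G-ne5p2-5 lesson: a shape is tested by instantiating it).  On the owner's toy carriers `volToyCarriers` (domains
`(j, x)` = (scale, position), tree length `0`) and toy history space `ToyHist = ℕ →ᵇ ℂ` (SUP norm — the KIND of the Hist of record), the toy
KERNEL DATUM `volKer N ω ϑ` reads at step `k` the domains `(j, x)`, `j < k`, `x < N`, with insertion-operator data `true` (run A) ∕ `false`
(run B) and ENTRY-LOCAL age-free kernels `ker k true (j, x) = ϑ^k • 𝟙_x`, `ker k false _ = 0` (so the two runs' kernels differ by `ϑ^k • 𝟙_x`):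
* `volKer_kerBudget_le` — the GLOBAL `KerBudget … 0 c` implies `N·ϑ ≤ c`; `volKer_kerRate_le` — the GLOBAL `KerRate … 0 δv ϑ` implies `N ≤ δv`
  (`0 < ϑ`): both volume-extensive; `volKer_not_kerRate_one` — at `N = 2` the global rate with `δv = 1` is FALSE;
* `volKer_kerBudgetLoc` ∕ `volKer_kerBudgetBLoc` ∕ `volKer_kerRateLoc` — the PER-READ-OUT binders hold with `c = δv = 1` along `evalCLM` for
  EVERY `N` (`0 ≤ ϑ ≤ 1`);
* `volKer_insScaleBound`, `volKer_insertionRate` — the consumers of `B13HistInsertionLoc` §5 end to end on the toy step model `volKerStep`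
  (both insertions read from the kernel datum BY CONSTRUCTION, bases `0`): `InsScaleBound univ 0 E₁ 1 ω` and
  `InsertionRate univ 0 E₀ (0 + E₀·(1·(1 − ω)⁻¹)) ϑ`, constants independent of `N`.
0 sorry; axioms ⊆ {propext, Classical.choice, Quot.sound}.
-/

noncomputable section

open scoped BigOperators
open Finset

namespace Summit.QuantumFields.BalabanUV.T4Continuum.B13HistInsertionLocWitness

open Literature.MathematicalPhysics.QuantumFieldTheory.Balaban1983to89.T4OutputRate (Carriers)
open Literature.MathematicalPhysics.QuantumFieldTheory.Balaban1983to89.T4InputCauchyRateData (StepModel)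
open Summit.QuantumFields.BalabanUV.T4Continuum.InsertionLinearRate (LinearPair.BaseRate)
open Summit.QuantumFields.BalabanUV.T4Continuum.InsertionLinearClassLocWitness (volToyCarriers ToyHist ind ind_apply)
open Summit.QuantumFields.BalabanUV.T4Continuum.B13HistInsertion (KernelDatum)
open Summit.QuantumFields.BalabanUV.T4Continuum.B13HistInsertionRate.KernelDatum (linB KerRate)
open Summit.QuantumFields.BalabanUV.T4Continuum.B13HistInsertionLoc.KernelDatum

/-- The toy kernel datum with `N` positions per scale: domains `(j, x)`, `j < k`, `x < N`; base `0`; insertion-operator data `true` (run A)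
∕ `false` (run B); age-free kernels `ϑ^k • 𝟙_x` for run A and `0` for run B; age damping `ω`. [folklore] -/
def volKer (N : ℕ) (ω ϑ : ℝ) : KernelDatum volToyCarriers Bool ToyHist where
  dom k := Finset.range k ×ˢ Finset.range N
  dom_lt _ _ hY := Finset.mem_range.1 (Finset.mem_product.1 hY).1
  base _ _ := 0
  ker k a Y := if a then (((ϑ ^ k : ℝ)) : ℂ) • ind Y.2 else 0
  ω := ω
  insOpA _ _ _ := true
  insOpB _ _ _ := false

/-- The toy step model: scalar operators, zero output, insertions READ FROM THE KERNEL DATUM (both runs), unit margins. [folklore] -/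
def volKerStep (N : ℕ) (ω ϑ : ℝ) : StepModel volToyCarriers ℂ ToyHist where
  Out := fun _ _ _ _ => 0
  opA := fun _ _ _ => 0
  opB := fun _ _ _ => 0
  insA := (volKer N ω ϑ).toInsDatum.insA
  insB := (volKer N ω ϑ).toInsDatum.insB
  Base := fun _ _ _ => Set.univ
  rOp := fun _ => 1
  rHist := fun _ => 1
  rOp_pos := fun _ => one_pos
  rHist_pos := fun _ => one_pos

variable {N : ℕ} {ω ϑ : ℝ}

/-- Run A reads the kernel datum (by construction). [folklore] -/
theorem volKer_readsA (N : ℕ) (ω ϑ : ℝ) : (volKer N ω ϑ).toInsDatum.ReadsA (volKerStep N ω ϑ) Set.univ :=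
  fun _ _ _ _ _ => rfl

/-- Run B reads the kernel datum (by construction). [folklore] -/
theorem volKer_readsB (N : ℕ) (ω ϑ : ℝ) : (volKer N ω ϑ).toInsDatum.ReadsB (volKerStep N ω ϑ) Set.univ :=
  fun _ _ _ _ _ => rfl

/-- The scale-`j` fibre read at step `k > j` is `{j} × {0, …, N − 1}`. [folklore] -/
theorem fibre_eq {k j : ℕ} (hj : j < k) : (volKer N ω ϑ).fibre k j = ({j} : Finset ℕ) ×ˢ Finset.range N := by
  ext ⟨a, x⟩
  simp only [KernelDatum.fibre, volKer, Finset.mem_filter, Finset.mem_product, Finset.mem_range, Finset.mem_singleton]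
  constructor
  · rintro ⟨⟨-, hx⟩, rfl⟩; exact ⟨rfl, hx⟩
  · rintro ⟨rfl, hx⟩; exact ⟨⟨hj, hx⟩, rfl⟩

/-- The indicator table has sup norm `1`. [folklore] -/
theorem norm_ind (x : ℕ) : ‖ind x‖ = 1 := by
  refine le_antisymm ((BoundedContinuousFunction.norm_le zero_le_one).2 fun y => ?_) ?_
  · by_cases h : y = x <;> simp [h]
  · simpa using (ind x).norm_coe_le_norm x

/-- Run A's kernel at `(j, x)` is `ϑ^k • 𝟙_x`, run B's is `0`. [folklore] -/
theorem ker_A (k : ℕ) (g : ℕ → ℝ) (U : Unit) (Y : ℕ × ℕ) :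
    (volKer N ω ϑ).ker k ((volKer N ω ϑ).insOpA g U k) Y = (((ϑ ^ k : ℝ)) : ℂ) • ind Y.2 := rfl

/-- Run B's kernel vanishes. [folklore] -/
theorem ker_B (k : ℕ) (g : ℕ → ℝ) (U : Unit) (Y : ℕ × ℕ) : (volKer N ω ϑ).ker k ((volKer N ω ϑ).insOpB g U k) Y = 0 := rfl

/-- The sup norm of run A's kernel: `ϑ^k` (`0 ≤ ϑ`). [folklore] -/
theorem norm_ker_A (hϑ : 0 ≤ ϑ) (k : ℕ) (g : ℕ → ℝ) (U : Unit) (Y : ℕ × ℕ) :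
    ‖(volKer N ω ϑ).ker k ((volKer N ω ϑ).insOpA g U k) Y‖ = ϑ ^ k := by
  rw [ker_A, norm_smul, Complex.norm_real, Real.norm_of_nonneg (pow_nonneg hϑ _), norm_ind, mul_one]

/-- The read-out of run A's kernel at position `e`: `ϑ^k` at `x = e`, else `0`. [folklore] -/
theorem norm_eval_ker_A (hϑ : 0 ≤ ϑ) (k : ℕ) (g : ℕ → ℝ) (U : Unit) (Y : ℕ × ℕ) (e : ℕ) :
    ‖BoundedContinuousFunction.evalCLM ℂ e ((volKer N ω ϑ).ker k ((volKer N ω ϑ).insOpA g U k) Y)‖ =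
      if Y.2 = e then ϑ ^ k else 0 := by
  rw [ker_A, BoundedContinuousFunction.evalCLM_apply, BoundedContinuousFunction.smul_apply, ind_apply, smul_eq_mul]
  by_cases h : Y.2 = e
  · subst h; simp [abs_of_nonneg hϑ]
  · have : ¬ e = Y.2 := fun h' => h h'.symm
    simp [this, h]

/-! ## The global binders are volume-extensive -/

/-- **THE GLOBAL KERNEL BUDGET IS VOLUME-EXTENSIVE**: `KerBudget (volKer N ω ϑ) (volKerStep N ω ϑ) univ 0 c ⟹ N·ϑ ≤ c` — at step `1`,
scale `0`, the `e^{0}`-weighted ℓ¹ sum of the `N` kernels of norm `ϑ` is `N·ϑ`, the right side `1·c`. [folklore] -/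
theorem volKer_kerBudget_le (hϑ : 0 ≤ ϑ) {c : ℝ} (h : (volKer N ω ϑ).KerBudget (volKerStep N ω ϑ) Set.univ 0 c) :
    (N : ℝ) * ϑ ≤ c := by
  have h1 := h 1 (fun _ => 0) (Set.mem_univ _) () 0 one_pos
  rw [fibre_eq one_pos, Finset.sum_product, Finset.sum_singleton] at h1
  simp_rw [zero_mul, neg_zero, Real.exp_zero, one_mul, norm_ker_A hϑ] at h1
  have hr : (volKerStep N ω ϑ).rHist 1 = 1 := rfl
  simpa [hr] using h1

/-- **THE GLOBAL KERNEL RATE IS VOLUME-EXTENSIVE**: `KerRate (volKer N ω ϑ) (volKerStep N ω ϑ) univ 0 δv ϑ ⟹ N ≤ δv` (`0 < ϑ`) — at step `1`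
the ℓ¹ discrepancy of the two runs' kernels is `N·ϑ`, the right side `δv·ϑ·1`. [folklore] -/
theorem volKer_kerRate_le (hϑ : 0 < ϑ) {δv : ℝ} (h : KerRate (volKer N ω ϑ) (volKerStep N ω ϑ) Set.univ 0 δv ϑ) :
    (N : ℝ) ≤ δv := by
  have h1 := h 1 (fun _ => 0) (Set.mem_univ _) () 0 one_pos
  rw [fibre_eq one_pos, Finset.sum_product, Finset.sum_singleton] at h1
  simp_rw [ker_B, sub_zero, zero_mul, neg_zero, Real.exp_zero, one_mul, norm_ker_A hϑ.le] at h1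
  have hr : (volKerStep N ω ϑ).rHist 1 = 1 := rfl
  rw [hr, mul_one, pow_one, Finset.sum_const, Finset.card_range, nsmul_eq_mul] at h1
  exact le_of_mul_le_mul_right h1 hϑ

/-- At `N = 2` the global kernel rate with `δv = 1` is FALSE (`0 < ϑ`). [folklore] -/
theorem volKer_not_kerRate_one (hϑ : 0 < ϑ) : ¬ KerRate (volKer 2 ω ϑ) (volKerStep 2 ω ϑ) Set.univ 0 1 ϑ :=
  fun h => by have := volKer_kerRate_le hϑ h; norm_num at this

/-! ## The per-read-out binders hold with constant `1` for every `N` -/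

/-- The per-read-out fibre sum of run A's kernels at position `e`: `ϑ^k` if `e < N`, else `0`. [folklore] -/
theorem sum_fibre_eval_ker_A (hϑ : 0 ≤ ϑ) {k j : ℕ} (hj : j < k) (g : ℕ → ℝ) (U : Unit) (e : ℕ) :
    ∑ Y ∈ (volKer N ω ϑ).fibre k j, Real.exp (-((0 : ℝ) * volToyCarriers.d Y)) *
        ‖BoundedContinuousFunction.evalCLM ℂ e ((volKer N ω ϑ).ker k ((volKer N ω ϑ).insOpA g U k) Y)‖ =
      if e ∈ Finset.range N then ϑ ^ k else 0 := by
  rw [fibre_eq hj, Finset.sum_product, Finset.sum_singleton]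
  simp_rw [zero_mul, neg_zero, Real.exp_zero, one_mul, norm_eval_ker_A hϑ]
  exact Finset.sum_ite_eq' (Finset.range N) e fun _ => ϑ ^ k

/-- **RUN A'S PER-READ-OUT KERNEL BUDGET HOLDS WITH `c = 1` FOR EVERY `N`** (`0 ≤ ϑ ≤ 1`). [folklore] -/
theorem volKer_kerBudgetLoc (N : ℕ) (ω : ℝ) (hϑ : 0 ≤ ϑ) (hϑ1 : ϑ ≤ 1) :
    KerBudgetLoc (volKer N ω ϑ) (volKerStep N ω ϑ) Set.univ 0 1 fun e : ℕ => BoundedContinuousFunction.evalCLM ℂ e := by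
  intro k g _ U j hj e
  have hr : (volKerStep N ω ϑ).rHist k = 1 := rfl
  rw [sum_fibre_eval_ker_A hϑ hj, hr, one_mul]
  split_ifs
  · exact pow_le_one₀ hϑ hϑ1
  · exact zero_le_one

/-- **RUN B'S PER-READ-OUT KERNEL BUDGET HOLDS WITH `c = 0`** (its kernels vanish) — a fortiori with any `c ≥ 0`. [folklore] -/
theorem volKer_kerBudgetBLoc (N : ℕ) (ω ϑ : ℝ) {c : ℝ} (hc : 0 ≤ c) :
    KerBudgetBLoc (volKer N ω ϑ) (volKerStep N ω ϑ) Set.univ 0 c fun e : ℕ => BoundedContinuousFunction.evalCLM ℂ e := by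
  intro k g _ U j hj e
  have hr : (volKerStep N ω ϑ).rHist k = 1 := rfl
  simp_rw [ker_B, map_zero, norm_zero, mul_zero, Finset.sum_const_zero, hr, one_mul]
  exact hc

/-- **THE PER-READ-OUT KERNEL RATE HOLDS WITH `δv = 1` FOR EVERY `N`** (`0 ≤ ϑ`): at position `e` only the kernel at `x = e` contributes,
with read-out discrepancy `ϑ^k ≤ 1·ϑ^k·1`. [folklore] -/
theorem volKer_kerRateLoc (N : ℕ) (ω : ℝ) (hϑ : 0 ≤ ϑ) :
    KerRateLoc (volKer N ω ϑ) (volKerStep N ω ϑ) Set.univ 0 1 ϑ fun e : ℕ => BoundedContinuousFunction.evalCLM ℂ e := by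
  intro k g _ U j hj e
  have hr : (volKerStep N ω ϑ).rHist k = 1 := rfl
  simp_rw [ker_B, sub_zero]
  rw [sum_fibre_eval_ker_A hϑ hj, hr, one_mul, mul_one]
  split_ifs
  · exact le_rfl
  · exact pow_nonneg hϑ _

/-! ## The consumers end to end, constants independent of `N` -/

/-- **W3 END TO END**: `InsScaleBound univ 0 E₁ 1 ω` for the toy step model from run A's per-read-out kernel budget through
`insScaleBound_of_kerBudget_eval` (`0 ≤ ω`, `0 ≤ ϑ ≤ 1`, `0 ≤ E₁`) — the constant `c = 1` for every `N`. [folklore] -/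
theorem volKer_insScaleBound (N : ℕ) {E₁ : ℝ} (hω : 0 ≤ ω) (hϑ : 0 ≤ ϑ) (hϑ1 : ϑ ≤ 1) (hE₁ : 0 ≤ E₁) :
    (volKerStep N ω ϑ).InsScaleBound Set.univ 0 E₁ 1 ω :=
  insScaleBound_of_kerBudget_eval (volKer_readsA N ω ϑ) (volKer_kerBudgetLoc N ω hϑ hϑ1) zero_le_one hω hE₁

/-- The two runs' base parts coincide (both `0`): `BaseRate` with `δb = 0`. [folklore] -/
theorem volKer_baseRate (N : ℕ) (ω ϑ θ : ℝ) :
    LinearPair.BaseRate (volKer N ω ϑ).linA (linB (volKer N ω ϑ)) (volKerStep N ω ϑ) Set.univ 0 θ := by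
  intro k g _ U
  change ‖(0 : ToyHist) - 0‖ ≤ 0 * θ ^ k * (volKerStep N ω ϑ).rHist k
  rw [sub_zero, norm_zero, zero_mul, zero_mul]

/-- **W4 END TO END**: `InsertionRate univ 0 E₀ (0 + E₀·(1·(1 − ω)⁻¹)) ϑ` for the toy step model from the per-read-out kernel rate through
`insertionRate_of_kernelRates_eval` (`0 ≤ ω < 1`, `0 ≤ ϑ`, `0 ≤ E₀`) — the constant `δv = 1` for every `N`. [folklore] -/
theorem volKer_insertionRate (N : ℕ) {E₀ : ℝ} (hω : 0 ≤ ω) (hω1 : ω < 1) (hϑ : 0 ≤ ϑ) (hE₀ : 0 ≤ E₀) :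
    (volKerStep N ω ϑ).InsertionRate Set.univ 0 E₀ (0 + E₀ * (1 * (1 - ω)⁻¹)) ϑ :=
  insertionRate_of_kernelRates_eval (volKer_readsA N ω ϑ) (volKer_readsB N ω ϑ) (volKer_baseRate N ω ϑ ϑ)
    (volKer_kerRateLoc N ω hϑ) hω hω1 zero_le_one hϑ hE₀

end Summit.QuantumFields.BalabanUV.T4Continuum.B13HistInsertionLocWitness

end
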